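import Literature.NumberTheory.EllipticCurves.GreenbergVatsal2000.EisensteinCongruenceResidualGoodOrdinary
import Literature.NumberTheory.EllipticCurves.Wuthrich2014.ReducibleDivisibilityCyclotomicPrimeHalf
import HarnessLib

/-!
# Greenberg–Vatsal 2000, §3 Thm. (3.12) (and Thm. (3.11) for even `χ`) + (26)–(28) + pp. 41–43,
# with §2 pp. 28–30, READ AT THE TAME CHARACTER `χ = ω^{(p−1)/2}`: for the `ω^{(p−1)/2}`-BRANCH
# `L_{Σ₀}(E/ℚ, ω^{(p−1)/2}, T)` of a GOOD ORDINARY Eisenstein prime, `μ = 0` and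
# `λ = dim H¹(ℚ_Σ/ℚ_∞, Φ ⊗ χ) + dim U(Ψ ⊗ χ)` — the residual groups being those of the
# QUADRATIC TWIST `E ⊗ χ_{p*}` (one named reading-fact; the branch twin of
# `nonPrimitive_unitContent_and_lambda_eq_residual_of_lineRamifiedEven_goodOrd`)

HONEST FRAMING (cell `bsd-eis`, home `run/shared/lean/pub/bsd-eis/`, seat `bsd-eis-x3`, memo
`x3-MEMO-1.md` §3 L4 / §5 R1(a); FULL-BSD-RANK1 programme tranche 1a, rows B2/B6 X3-shares): the
cell types the Eisenstein (reducible `E[p]`) inputs of the rank-`≤ 1` BSD residue from PUBLISHED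
theorems; nothing is booked by this file; X3 stays CONSTRUCTION-SHAPED. This file records ONE
published statement as a named reading-fact (`def … : Prop`, nothing asserted; D-0014/D-0026:
exactly one new named fact, no definition). It is the `χ = ω^{(p−1)/2}` instance of the
`TODO(general form)` left in `EisensteinCongruenceResidualGoodOrdinary.lean` ("GV prove the
congruence for every even Dirichlet character `χ` (tame at `p`); only `χ = 1` is filed"), in the
vocabulary of the tree's `ω^i`-branches (`padicLFunctionBranch` / `padicLFunctionMinusBranch`,
MTT §I.13) and with the residual groups of the curve `W = E ⊗ χ_{p*}` (additive at `p`; `W[p] ≅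
E[p] ⊗ χ`), which are the groups `H¹(ℚ_Σ/ℚ_∞, Φ ⊗ χ)`, `U(Ψ ⊗ χ)` of GV's characters `χφ`, `χψ`.

WHY (reach, not mathematics). For an X3 pair `(W, p)` on the semistable-twist locus (`W` additive
at `p`, `W[p]` reducible, `V := W ⊗ χ_{p*}` good ordinary at `p`) the LOWER half of `BSD(W,p)` is
the `ω^{(p−1)/2}`-branch main conjecture of `V` (`Summits/…/Additive/X3BranchLambda.lean`,
`X3BranchMainConjectureAt V p`), reduced in the kernel to a `λ`-equality plus an analytic `μ = 0`
bit (`x3BranchMainConjectureAt_of_lambdaEq_of_muZero`), and further to the two typed halves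
`X3BranchAnalyticLambdaAt V p n ∧ X3BranchAlgebraicLambdaAt V p n`
(`Summits/…/Additive/X3BranchIsogenyCharacters.lean`). THIS fact is the printed source of the
ANALYTIC half: it gives `n = dim H¹(ℚ_Σ/ℚ_∞, Φ_W) + dim U(Ψ_W) − Σ_{ℓ∈Σ₀} s_ℓ d_ℓ(W)` for the
`ω^{(p−1)/2}`-branch of `V` (seat numerics, memo §4: the resulting identity
`λ = 2λ(L_p(φ_W,·)) + Σ s_ℓ t_ℓ(W)` holds on 77/77 + 64/64 rows).

## Citation header (held text arXiv:math/9906215 = `paper:arxiv-math_9906215`, dvips stream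
## decoded — cell copies `run/shared/lean/pub/bsd-eis/lit/src/gv00-clean/`, seat copy
## `work/lit/gv_p00NN.w.txt`; p00NN = arXiv page NN−23)

* §3 p. 32 (p0055): "Let `E` be a modular elliptic curve of conductor `N`, and let `p` be a fixed
  odd prime. We assume that `E` has either good ordinary or multiplicative reduction at `p` … If
  `E[p]` is reducible, then … there exists a character `ψ : Gal(ℚ̄/ℚ) → 𝔽_p^×` such that the
  Jordan–Hölder factors of `E[p]` are given by `ψ` and `ωψ⁻¹`. … If we let `φ = ωψ⁻¹`, then
  `ρ_m = φ ⊕ ψ`. (17) We may assume that `ψ` is unramified at `p`. Then we choose a sign `α = ±` as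
  follows: … 2. If `E[p]` is reducible, then `α` is determined by `α1 = −ψ(−1)`."
* pp. 38–39 (p0061–p0062): "Thus let `K` be an abelian number field. We assume that `K` is
  unramified at all primes dividing the level `N`, and tamely ramified at `p`. The curve `E` is
  assumed of course to have ordinary reduction at `p`. Put `G = Gal(K/ℚ)`, and fix a character `χ`
  of `G`. … the `χ`-twisted `p`-adic `L`-function of `f` is defined to be a power series
  `L(f, χ, T)` … satisfying the following interpolation property for every nontrivial character `ρ`
  of `Γ`: `L(f, χ, ζ_ρ − 1) = τ(ρ⁻¹χ⁻¹) α_p(f)^{−m} L(f, ρχ, 1)/((−2πi)^{?} Ω^α_f)` (24) … The sign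
  `α` is determined by `±1 = χ(−1)`. … The `p`-adic `L`-function of an elliptic curve is defined in
  a similar manner. Namely, one takes the `p`-adic `L`-function of the corresponding modular form
  `f`, and specifies the period by replacing `(−2πi)Ω^α_f` with the Néron period `Ω^α_E`."
  Prop. (3.7): "Assume either that `E` is optimal, or that `E[p]` is irreducible. Assume that the
  character `χ` is unramified at all primes dividing `N`, and that `χ` is tamely ramified at `p`.
  Then the `L`-function `L(E/ℚ, χ, T)` is integral". Cor. (3.8) (p0063): "Assume that `E` admits
  a cyclic `p`-isogeny with kernel `Φ`, such that `Φ` is either unramified at `p` and odd, or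
  ramified at `p` and even, as a Galois module. Then the `χ`-twisted `p`-adic `L`-function of `E`
  is represented by an integral power series, for any even character `χ`. If `E_opt` is the optimal
  curve in the isogeny class of `E`, then the period `Ω⁺_E` coincides with `Ω⁺_{E_opt}`, up to
  `p`-adic unit."
* pp. 41–42 (p0064–p0065): "we will prove a more general result by allowing a twist by a
  Dirichlet character `χ`. … `L_p(ωψ⁻¹χ⁻¹, s) = L(C, χ, κ(γ)^{−s} − 1)` … note that `ωψ⁻¹ = φ`.
  The Ferrero-Washington theorem asserts that `L(C, χ, T) ∉ pΛ` and the Mazur-Wiles theorem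
  implies that the `λ`-invariant of `L(C, χ, T)` is equal to `corank_O(S_{C⊗χ}(ℚ_∞))`, which we
  denoted by `λ_{χωψ⁻¹}` … The `λ`-invariant of `L_{Σ₀}(C, χ, T)` is `λ_{χωψ⁻¹,Σ₀} = λ_{χφ,Σ₀}`.
  … `L_p(ωχ⁻¹ψ⁻¹, s) = ½ L(D, χ, κ(γ)^s − 1)` … The `μ`-invariant of `L(D, χ, T)` is again zero
  and its `λ`-invariant is `λ_{ωχ⁻¹ψ⁻¹} = λ_{χψ}`, which is equal to `corank_O(S_{D⊗χ}(ℚ_∞))`. …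
  `L(G, χ, T) = L_{Σ₀}(C, χ, T) L_{Σ₀}(D, χ, T)` (28)"; p. 43 (p0066): "The `μ`-invariant of
  `L(G, χ, T)` is zero because that is true for each factor in (28). Also, the `λ`-invariant of
  `L(G, χ, T)` is equal to `λ_{χφ,Σ₀} + λ_{χψ,Σ₀}`. The two terms are the `O`-coranks of
  `S^{Σ₀}_{C⊗χ}(ℚ_∞)` and `S^{Σ₀}_{D⊗χ}(ℚ_∞)`, respectively." Thm. (3.11): "Let `χ` be any even
  character. Then we have congruence `L_{Σ₀}(E/ℚ, χ, T) ≡ u L(G, χ, T) (mod π)`, where `u` is a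
  unit in `O`."
* pp. 44–45 (p0067–p0068), "Modular forms with non-rational coefficients": "let `f = Σ a_n q^n`
  denote a weight 2 eigenform on `Γ_1(N)`, with coefficients in the `p`-adic integer ring `O`. …
  We assume as usual that `N` is divisible by at most the first power of `p`, and that `a_p` is a
  unit in `O`. … `ρ_m` reducible … `ρ_m = φ ⊕ ψ`. … the characters `φ` and `ψ` are distinct when
  restricted to the decomposition group `D_p`. Such a representation is said to be
  `p`-distinguished … This condition will always be satisfied if, for instance, the level `N` is
  prime to `p`. … we single out the character `ψ` by requiring that it be unramified, and that it
  satisfy `ψ(Frob(p)) = a_p` … Let `α = ±` be the choice of sign determined by `−ψ(−1) = α1`. …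
  Let `χ` be any Dirichlet character with conductor prime to `N`, and with `χ(−1) = −ψ(−1)`. … Let
  `Σ₀` denote any finite set of primes, with `p ∉ Σ₀`, and containing all other primes `q ≠ p`
  dividing `N`. … **Theorem (3.12)** Assume that `ρ_m` is `p`-distinguished. Then there exists an
  invertible power series `U(T)` such that the following congruence holds:
  `L_{Σ₀}(f, χ, T) ≡ U(T) L_{Σ₀}(φ̃ω⁻¹χ, T) L_{Σ₀}(ψ̃⁻¹χ⁻¹, (1+T)⁻¹ − 1) (mod π)`. Thus, the
  invariant `μ^{anal}_f` is trivial. The main conjecture is true for `f`."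
* §2 p. 29 (p0052), for a ONE-DIMENSIONAL `A = (K/O)(θ)`, `θ` a character of `Gal(K_∞/ℚ)`,
  `p ∤ |Δ|`: "Assume first that `θ` is even. … `W_p = V_p` … `S_A(ℚ_∞) = Hom_Δ(X_∞, A)` …
  Ferrero-Washington … `λ_ξ = corank_O(S_A(ℚ_∞))` … Assuming that `ξ` is nontrivial (so that
  `H⁰(ℚ, A[π]) = 0`), proposition (2.6) implies that `λ_{ξ,Σ₀} = dim_{O/πO}(S^{Σ₀}_{A[π]}(ℚ_∞))`.
  … Assume now that `θ` is odd. … `W_p = 0` … `S_A(ℚ_∞) = H¹_unr(ℚ_Σ/ℚ_∞, A)` … Assume that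
  `ξ ≠ ω`. … Since `ξ` is odd, we have `H⁰(ℚ, A[π]) = 0` and therefore proposition (2.8) implies
  that `λ_{ξ,Σ₀} = dim_{O/πO}(S^{Σ₀}_{A[π]}(ℚ_∞))`"; p. 28: `S^{Σ₀}_{A_φ[p]}(ℚ_∞) = H¹(ℚ_Σ/ℚ_∞, Φ)`
  (no condition at `p`), `U = ker(H¹(ℚ_Σ/ℚ_∞, Ψ) → H¹(I_p, Ψ))`.

## Reading at `χ = ω^{(p−1)/2}` and transcription

Let `V/ℚ` be globally minimal with GOOD ORDINARY reduction at the odd prime `p` (`p ∤ N_V`,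
`p ∤ a_p` — so `f_V` has level prime to `p`, `ρ_m` is `p`-distinguished, and `χ := ω^{(p−1)/2}`, of
conductor `p`, is "tamely ramified at `p`" and has "conductor prime to `N`"), `V[p]` reducible with
`ψ` its constituent unramified at `p`; `χ` is the quadratic character of `K = ℚ(√p*)`,
`p* = (−1)^{(p−1)/2} p`, and `χ(−1) = (−1)^{(p−1)/2}`. Let `W` be a globally minimal model of the
quadratic twist `V ⊗ χ` (`C • V^{(p*)} = W`); then `W[p] ≅ V[p] ⊗ χ` as `Γ_ℚ`-modules, its
constituents are `χψ` and `χφ`, and a rational line `Φ₀ ≤ W[p]` whose `χ`-twist is RAMIFIED at `p`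
has character `χφ`, with quotient `Ψ_W = W[p]/Φ₀` of character `χψ`. The hypothesis
`χ(−1) = −ψ(−1)` of Thm. (3.12) reads: `χφ` is EVEN (as `φψ = ω` is odd), i.e. `LineEven W p Φ₀`
— for `(p−1)/2` even this is GV's Thm. (1.3) parity for `V`, for `(p−1)/2` odd the opposite
parity. The sign is `α = χ(−1)`: the period is the real period for `p ≡ 1 (mod 4)` and the
imaginary one for `p ≡ 3 (mod 4)` (the tree's branch convention: `padicLFunctionBranch` with
`plusPeriod`, `padicLFunctionMinusBranch` with `minusPeriod`, MTT §I.13–I.14). Folding Thm. (3.12)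
(congruence, `U ∈ Λ^×`), (26)–(28) (both Kubota–Leopoldt factors are `L_p(ωψ⁻¹χ⁻¹, ·) = L_p(χφ, ·)`
read in the variables `κ(γ)^{∓s} − 1`, hence lie in `Λ` with `μ = 0` by Ferrero–Washington) and
p. 29 (the `λ`-invariants are `dim H¹(ℚ_Σ/ℚ_∞, Φ ⊗ χ)` for the even nontrivial `χφ`, and `dim U`
for the odd `χψ ≠ ω`) exactly as the `χ = 1` reading-facts of this directory fold Thm. (3.11):
for every `b ∈ Λ` with `ι b = u·ϖ·L_p(f_V, α_V, ω^{(p−1)/2}, T)` (`ϖ·Ω^{sgn χ}_V = Ω^{sgn χ}_{f}`,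
`u ∈ ℤ_pˣ`), `b · ∏_{ℓ∈Σ₀} 𝒫_ℓ(W)` (the Euler factors of `L(f_V, χ, s)` at `ℓ ≠ p` are those of
`W = V ⊗ χ`) has unit content and
`p^{ord_T(· mod p)} = #H¹(ℚ_Σ/ℚ_∞, Φ₀) · #U(W[p]/Φ₀)` (`residualLineH1 W`, `residualQuotSelmer W`).
Side conditions made explicit as hypotheses (all hold for `p ≥ 5`; at `p = 3` they exclude the
case `{χφ, χψ} = {1, ω}` where Props. (2.6)/(2.8) and the proof of (3.11) ("`L(s,G)` is
holomorphic (`ψ ≠ 1`)", p. 43) do not apply): `Γ_ℚ` acts non-trivially on `Φ₀` (`χφ ≠ 1`).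
PERIOD / INTEGRALITY STEP: as in the `χ = 1` reading-facts, the Néron normalisation `ϖ·Ω_V = Ω_f`
is used and the conclusion includes `μ = 0`; GV prove integrality and the period comparison for
the optimal curve (Prop. (3.1), Prop. (3.7)) and, under the parity hypothesis, for every member
(Cor. (3.8): "by exactly the same argument as was used in the conclusion of the proof of Lemma
(3.6)" — stated there for even `χ`; Remark (3.9) records the general expectation) — flag
`GV00-branch-period` for the odd-`χ` sign, docstring-only.
-- TODO(general form): GV's Thm. (3.12) is stated for any `p`-ordinary weight-2 eigenform on
-- `Γ_1(N)` with coefficients in `O` and any `χ` of conductor prime to `N` with `χ(−1) = −ψ(−1)`;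
-- only the elliptic-curve case at `χ = ω^{(p−1)/2}` (good ordinary `p ∤ N`) is filed, with the
-- identifications of pp. 41–43 / p. 29 folded in (no Kubota–Leopoldt objects in the tree). The
-- multiplicative case (`p ‖ N`, `χ` ramified at `p`) is OUTSIDE GV's standing hypothesis
-- ("`K` unramified at all primes dividing the level `N`") and is NOT filed.

References: [GreenbergVatsal2000] §3 Thm. (3.12), Thm. (3.11), (24), (26)–(28), Prop. (3.7),
Cor. (3.8), pp. 32, 38–45; §2 pp. 28–30, Props. (2.6), (2.8); [MazurTateTeitelbaum1986Invent]
§I.13–I.14; [Washington1997] §7 (Ferrero–Washington, Mazur–Wiles as used by GV).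
-/

set_option autoImplicit false

noncomputable section

open scoped Classical AddSubgroup MatrixGroups ModularForm

open NumberField IsDedekindDomain Field WeierstrassCurve CongruenceSubgroup PowerSeries
open Literature.NumberTheory.EllipticCurves Literature.NumberTheory.GaloisRepresentations
  Literature.NumberTheory.EllipticCurves.ModularForms
  Literature.NumberTheory.EllipticCurves.Rank1Residual

namespace Literature.NumberTheory.EllipticCurves.GreenbergVatsal2000

/-- **Greenberg–Vatsal 2000, §3 Thm. (3.12) + (26)–(28) + pp. 41–43 (with §2 pp. 28–29) at the
tame quadratic character `χ = ω^{(p−1)/2}`, GOOD ORDINARY `p`: for the `ω^{(p−1)/2}`-branch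
`L_{Σ₀}(E/ℚ, ω^{(p−1)/2}, T)`, `μ = 0` and `λ = dim H¹(ℚ_Σ/ℚ_∞, Φ ⊗ χ) + dim U(Ψ ⊗ χ)`.**
Thm. (3.12) (p. 45): "Let `χ` be any Dirichlet character with conductor prime to `N`, and with
`χ(−1) = −ψ(−1)`. … Assume that `ρ_m` is `p`-distinguished. Then there exists an invertible power
series `U(T)` such that the following congruence holds:
`L_{Σ₀}(f, χ, T) ≡ U(T) L_{Σ₀}(φ̃ω⁻¹χ, T) L_{Σ₀}(ψ̃⁻¹χ⁻¹, (1+T)⁻¹ − 1) (mod π)`. Thus, the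
invariant `μ^{anal}_f` is trivial"; p. 44: "This condition [`p`-distinguished] will always be
satisfied if, for instance, the level `N` is prime to `p`"; pp. 41–43: both factors are
`L_p(ωψ⁻¹χ⁻¹, s)` in the variables `κ(γ)^{∓s} − 1`, "The Ferrero-Washington theorem asserts that
`L(C, χ, T) ∉ pΛ` and the Mazur-Wiles theorem implies that the `λ`-invariant of `L(C, χ, T)` is
equal to `corank_O(S_{C⊗χ}(ℚ_∞))` … `λ_{χφ,Σ₀}` … [that of `L_{Σ₀}(D, χ, T)`] is `λ_{χψ,Σ₀}`",
"The two terms are the `O`-coranks of `S^{Σ₀}_{C⊗χ}(ℚ_∞)` and `S^{Σ₀}_{D⊗χ}(ℚ_∞)`"; p. 29: these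
are `dim H¹(ℚ_Σ/ℚ_∞, ·)` (even nontrivial character, Prop. (2.6)) and `dim U` (odd character
`≠ ω`, Prop. (2.8)); p. 39 (24): sign `±1 = χ(−1)` and "one … specifies the period by replacing
`(−2πi)Ω^α_f` with the Néron period `Ω^α_E`". TRANSCRIPTION (`χ = ω^{(p−1)/2}`, the quadratic
character of `K = ℚ(√p*)`, `p* = (−1)^{(p−1)/2}p`): `V/ℚ` globally minimal, `p ≠ 2` of good
reduction with `p ∤ a_p(V)`, `V[p]` reducible; `W` a globally minimal model of `V ⊗ χ`
(`C • V^{(p*)} = W`, so `W[p] ≅ V[p] ⊗ χ` has constituents `χφ`, `χψ`); `κ` cyclotomic; `f` the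
newform of `V`; `Φ₀ ≤ W[p]` a rational line which is EVEN (`= χ(−1) = −ψ(−1)` for its character
`χφ`), on which `Γ_ℚ` acts non-trivially (`χφ ≠ 1`; automatic for `p ≥ 5`) and whose `χ`-twist is
RAMIFIED at `p` (so its character is `χφ`, not `χψ`); `S₀ ∌ p` finite containing every bad place
`≠ p` of `W` (= of `V`); `ϖ ∈ ℚ` with `ϖ·Ω⁺_V = Ω⁺_f` if `(p−1)/2` is even, `ϖ·Ω⁻_V = Ω⁻_f` if
odd (sign `α = χ(−1)`); every `b ∈ Λ` and `u ∈ ℤ_pˣ` with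
`ι b = u·ϖ·L_p(f, α_V, ω^{(p−1)/2}, T)` (`padicLFunctionBranch` / `padicLFunctionMinusBranch` at
`i = (p−1)/2`, MTT §I.13): then `b · eulerFactorProduct W p S₀` has unit content and
`p^{ord_T(b·∏𝒫 mod p)} = #residualLineH1 W p κ S₀ Φ₀ · #residualQuotSelmer W p κ S₀ Φ₀`. The
`ω^{(p−1)/2}`-branch twin of `nonPrimitive_unitContent_and_lambda_eq_residual_of_lineRamifiedEven_goodOrd`
(`χ = 1`). Period/integrality step for non-optimal `V`: GV Prop. (3.7) / Cor. (3.8) / Remark (3.9)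
(docstring flag `GV00-branch-period` for the odd sign). Named reading-fact; nothing asserted.
[cite: GreenbergVatsal2000, §3 Thm. (3.12) p. 45 with (24) p. 39, (26)–(28) pp. 41–42, p. 43, Prop. (3.7), Cor. (3.8); §2 pp. 28–29 Props. (2.6), (2.8)] -/
def thm312_branch_unitContent_and_lambda_eq_residual_goodOrd : Prop :=
  ∀ (V : WeierstrassCurve ℚ) [V.IsGloballyMinimal] [V.IsElliptic]
    (W : WeierstrassCurve ℚ) [W.IsGloballyMinimal] [W.IsElliptic] (p : ℕ) [Fact p.Prime]
    (K : Type) [Field K] [NumberField K] [(galRange (K := ℚ) K).Normal]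
    (κ : ZpExtension ℚ p) {N : ℕ} [NeZero N] (f : CuspForm (Gamma0 N) 2)
    (S₀ : Finset (HeightOneSpectrum (𝓞 ℚ)))
    (Φ₀ : AddSubgroup (W.geomTorsion (p : ℤ))) (hΦ : IsRationalLine W p Φ₀),
    p ≠ 2 → V.HasGoodReductionAtPrime p → ¬ (p : ℤ) ∣ V.frobeniusTrace p →
    ¬ V.HasIrreducibleModPGaloisRep p →
    Module.finrank ℚ K = 2 → (∃ θ : K, θ ^ 2 = algebraMap ℚ K ((-1) ^ (p / 2) * p)) →
    (∃ C : VariableChange ℚ, C • V.quadraticTwist ((-1) ^ (p / 2) * p : ℚ) = W) →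
    κ.IsCyclotomic → IsNewformOf V f →
    LineEven W p Φ₀ →
    (∃ (σ : absoluteGaloisGroup ℚ) (P : W.geomTorsion (p : ℤ)), P ∈ Φ₀ ∧ σ • P ≠ P) →
    (¬ ∀ v : HeightOneSpectrum (𝓞 ℚ), ((p : ℕ) : 𝓞 ℚ) ∈ v.asIdeal →
        ∀ 𝔓 ∈ v.primesAbove, ∀ σ ∈ 𝔓.inertia (absoluteGaloisGroup ℚ), ∀ P ∈ Φ₀,
          σ • P = (if σ ∈ galRange (K := ℚ) K then P else -P)) →
    (∀ v ∈ S₀, ((p : ℕ) : 𝓞 ℚ) ∉ v.asIdeal) →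
    (∀ v : HeightOneSpectrum (𝓞 ℚ), v ∉ S₀ → ((p : ℕ) : 𝓞 ℚ) ∉ v.asIdeal →
      W.HasGoodReductionAt v) →
    ∀ (ϖ : ℚ), (if Even (p / 2) then (ϖ : ℝ) * V.realPeriodRat = plusPeriod f
        else (ϖ : ℝ) * V.imaginaryPeriodRat = minusPeriod f) →
    ∀ (b : IwasawaAlgebra p) (u : ℤ_[p]ˣ),
      iwasawaToPowerSeries p b =
        PowerSeries.C ((((u : ℤ_[p]) : ℚ_[p])) * ((ϖ : ℚ) : ℚ_[p])) *
          (if Even (p / 2) then padicLFunctionBranch f ((unitRoot V p : ℤ_[p]) : ℚ_[p]) (p / 2)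
            else padicLFunctionMinusBranch f ((unitRoot V p : ℤ_[p]) : ℚ_[p]) (p / 2)) →
      HasUnitContent (b * eulerFactorProduct W p S₀) ∧
        p ^ (PowerSeries.map (PadicInt.toZMod (p := p)) (b * eulerFactorProduct W p S₀)).order.toNat =
          Nat.card (residualLineH1 W p κ S₀ Φ₀ hΦ) * Nat.card (residualQuotSelmer W p κ S₀ Φ₀ hΦ)

end Literature.NumberTheory.EllipticCurves.GreenbergVatsal2000

end
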